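import Literature.MathematicalPhysics.QuantumFieldTheory.MagnenRivasseauSeneor1993.MRS93SlicedPropagatorDecay
import Literature.MathematicalPhysics.QuantumFieldTheory.MagnenRivasseauSeneor1993.MRS93AppendixFeynmanGauge
import HarnessLib

/-!
# Magnen–Rivasseau–Sénéor, *Construction of YM₄ with an infrared cutoff* (CMP 155, 1993), App. 1 (A.29): the SLICED HOMOTHETIC
# PROPAGATOR DECAY «κ_B^m ∗ (−Δ_B^{homothetic})^{−1}(x, y) ≤ K_q M^{2m}(1/(1 + M^m|x − y|))^q» PROVED AT ZERO BACKGROUND — every entry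
# `(μ, ν)` of the Fourier transform of `κ^m(p)·(δ_{μν} − (1 − ζ⁻¹)p_μp_ν/p²)/p²` (MRS's own slices (II.15) of the cutoff (II.14), any gauge
# parameter `ζ`) obeys the printed bound with ONE `K_q` for all slices `m ≥ 1` and all entries; the tree's AS-PRINTED predicate
# `AppendixOne.IneqA29Printed` is DISCHARGED for this kernel family

real analysis on `ℝ⁴` — smoothness and compact support of the unit-scale profile, file 44's integration-by-parts Fourier decay and
its exact-dilation transport (EDITION v1.1 adds: the same bound, with the same `K_q`, for the TRANSLATED free model of p.383 tl.11–13 ∕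
(V.2), and the `e^{ip·(x−y)}` phase convention); nothing here is a claim about the Yang–Mills mass gap, about continuum YM₄ on `T⁴`, or about the Clay
problem — and nothing is asserted about the operator WITH a constant non-zero background (the «translated zero» of (A.28), the slices
`κ_B^m` of (V.2) centred at `λ(B̄′)·e`), about Sect. V's resolvent expansion, or about the horizontal cluster expansion that uses (A.29)

**Citation header (reproduction of PUBLISHED work).** J. Magnen, V. Rivasseau, R. Sénéor, *Construction of YM₄ with an infrared
cutoff*, Commun. Math. Phys. **155** (1993) 325–383 [MagnenRivasseauSeneor1993], Appendix 1 (A.29) p.383 tl.13–18; Sect. V (V.2)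
p.358; Sect. III (III.3) p.348 (the homothetic-gauge propagator); §II.A (II.13)–(II.15) p.331 (cutoff and slices); for §7 only,
V. Rivasseau, *From Perturbative to Constructive Renormalization* (Princeton 1991) [Rivasseau1991] §III.3 (III.3.3) PDF p.212 (the phase
convention `C = ∫e^{ip(x−y)}(…)d⁴p`). Loci «p.NNN [PDF nn]
tl.k» = journal page, PDF page (= journal page − 324), text-layer line of `paper:magnen1993-cmp155-mrs-ym4-infrared-cutoff`; (V.2) and
(A.29) re-read on the page images `renders-cmp155/p34_full_s6.png`, `p59_full_s6.png`. Cell pub-balaban-gaps (YM blitz, track G3),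
seat mrs-lit-2 (gen 18, file 51); companion record `run/shared/lean/pub/pub-balaban-gaps/g3/MRS-AS-PRINTED-estimates.md`.
Siblings USED, not re-typed: `…MRS93SlicedPropagatorDecay` (this seat, file 44: the coordinates `E4`, `timeC`, `spat`, `emb`, the
scaling `scale`, the unit slice profile `unitSlice` with `sliceCutoff_succ_eq_unitSlice` ∕ `unitSlice_eq_zero_of_le` ∕ `_of_ge` ∕
`contDiff_unitSlice`, the generic `exists_fourier_family_le` (smooth compactly supported family ⟹ uniform Fourier decay) and
`abs_re_fourier_le_of_scale` (exact dilation ⟹ scaled decay), `fourier_comp_symm`), `…MRS93AppendixFeynmanGauge` (this seat, file 7 — mis-numbered «file 10» in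
v1 of this docstring: the predicate
`AppendixOne.IneqA29Printed` = (A.29) AS PRINTED, `∀ q ∃ K_q ∀ m ∀ z`), `…MRS93StartingAnsatz` (mrs-lit-1: `Ansatz.cutoffFn` (II.14),
`Ansatz.sliceCutoff` (II.15), `Ansatz.contDiff_comp_norm_mul`).

**What the paper prints (verbatim).**
* App. 1 p.383 [PDF 59] tl.11–18: *«We can consider that for a fixed B (with approximate alignment of all components in su(2) space)
  the zero at p = 0 of the ordinary Laplace operator p² is simply translated. If we use a cutoff function κ_B^m as in (V.2) with correct
  scaling around this translated zero of the operator (−Δ_B^{homothetic}) with constant background, we obtain the correct polynomial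
  bounds on the spatial decay using integration by parts on the cutoff function: κ_B^m ∗ (−Δ_B^{homothetic})^{−1}(x, y) ≤
  K_q M^{2m}(1/(1 + M^m|x − y|))^q. (A.29) It is this decrease which is finally used in the horizontal cluster expansion.»*
* Sect. V p.358 [PDF 34], (V.2) and after: *«κ_l^{l′} = Σ_{m=l+1}^{l′} κ^m_{B′_{l,Δ}} + E_{l,B′_l(Δ)}, (V.2) where κ^m_{B′_{l,Δ}} restricts
  |p_μ − λ(B̄′_{l,Δ})_μ.e| to be of order M^m, i.e. we simply translate the cutoff without changing its shape (using the same C₀^∞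
  function)»* — at `B̄′ = 0` the translation is by `0`: `κ_B^m = κ^m`, the momentum slice of (II.15).
* Sect. V p.359 [PDF 35] lines 1–5 (page image `p35_full_s6.png`): *«In other words the set of slices is no longer cut around the point
  p = 0 but around the point p_μ = λB_μ.e. The important fact is that we have now for each slice of the propagator in the background
  field the same scaling and, using integration by parts, the same spatial decrease as for the ordinary slices with the ordinary
  propagator (see the Appendix). (The reader can think of the background field as a kind of mass so that when the momentum is not
  almost aligned with it, there is good spatial decay.)»* — §6 proves «the same scaling and … the same spatial decrease» for the
  translated free model, with the same constant.
* Sect. III (III.3) p.348: the homothetic-gauge gluon propagator *«δ_ab(δ_μν − (1 − ζ⁻¹)p_μp_ν/p²)/p²»* (quoted in the tree by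
  `MRS93HomotheticDeterminantTransfer`), i.e. `(−Δ^{homothetic})^{−1}` at zero background.

**What is formalised (every statement below is a `theorem` with its proof; `P` the cutoff profile, `η > 0`, `M > 1`, `ζ` real).**
* §1 `scale_self_eq_smul` (file 44's `scale a a = a • id`), `emb_timeC_spat` (`ℝ⁴ = ℝ × ℝ³`).
* §2 DEFINITIONS with bodies: `homNum ζ μ ν p = δ_{μν}|p|² − (1 − ζ⁻¹)p_μp_ν`; `unitHom P η M ζ μ ν v = ψ(|v|)·homNum(v)/|v|⁴` (the
  unit-scale profile, `ψ = unitSlice`); `homSliceMom … m p = κ^m(|p|)·homNum(p)/|p|⁴` (the `(μ,ν)` entry of the sliced zero-background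
  homothetic propagator in momentum space, `κ^m = Ansatz.sliceCutoff m`); `homSliceKernel … m z = Re 𝓕[homSliceMom m](z)` (position
  space); `kernelFamily` (all `m ∈ ℕ`: the slices `m ≥ 1`, extended by `0` at the bottom block `m = 0`).
* §3 `contDiff_homNum`, `homNum_smul` (degree-2 homogeneity), **`contDiff_unitHom`** (C^∞ on `ℝ⁴`: identically `0` for `|v| < M⁻¹`,
  smooth off `0`), **`support_unitHom_subset`** (support in the closed ball of radius `3 + η⁻¹`), **`exists_fourier_unitHom_le`** (for
  every `n` ONE `K ≥ 0`: `|𝓕[Φ_{μν}](w)| ≤ K(1 + |w|)^{−n}` for all sixteen entries).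
* §4 **`homSliceMom_scale`**: `C^{k+1}_{μν}(M^{k+1}v) = M^{−2(k+1)}·Φ_{μν}(v)` (exact dilation: `κ^{k+1}(r) = ψ(r/M^{k+1})`, `homNum/|·|⁴`
  homogeneous of degree `−2`).
* §5 **`exists_homSliceKernel_bound`** (`∀ q ∃ K_q ≥ 0 ∀ μ ν ∀ m ≥ 1 ∀ z`: `|G^m_{μν}(z)| ≤ K_q M^{2m}(1 + M^m|z|)^{−q}`) and
  **`ineqA29Printed_kernelFamily`**: `AppendixOne.IneqA29Printed (kernelFamily P η M ζ μ ν) M` for every entry `(μ, ν)` — (A.29) in its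
  printed quantifier shape, DISCHARGED at zero background.
* §6 (EDITION v1.1) «for a fixed B … the zero at p = 0 of the ordinary Laplace operator p² is simply translated» (p.383 tl.11–13) ∕ (V.2)
  «we simply translate the cutoff without changing its shape»: the TRANSLATED MODEL `homSliceMomTr … p_B μ ν m p = C^m_{μν}(p − p_B)`,
  `homSliceKernelTr`, `kernelFamilyTr` (`kernelFamilyTr_zero`: at `p_B = 0` it is §2's family); `norm_fourier_le_of_scale` (the NORM
  form of file 44's assembly), `exists_norm_fourier_homSliceMom_le` (§5's bound on the complex modulus),
  **`exists_homSliceKernelTr_bound`** (ONE `K_q` for EVERY translation `p_B ∈ ℝ⁴`, all `m ≥ 1`, all entries: a momentum translation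
  is a position-space phase) and **`ineqA29Printed_kernelFamilyTr`**: `AppendixOne.IneqA29Printed (kernelFamilyTr P η M ζ p_B μ ν) M`.
* §7 (EDITION v1.1) the phase convention `∫ e^{ip·(x−y)}(…)d⁴p` of [R] (III.3.3) (as file 44 §8): `homSliceKernelTrPhys`,
  `kernelFamilyTrPhys`, **`ineqA29Printed_kernelFamilyTrPhys`** (`K_q ↦ (2π)^q K_q`), `ineqA29Printed_kernelFamilyPhys_zero`.

**Reading conventions.** (i) «(x, y)» ↦ the translation-invariant kernel as a function of `z = x − y ∈ ℝ⁴`; the predicate of file 7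
takes scalar kernels `G : ℕ → ℝ⁴ → ℝ`, so (A.29) is read ENTRY BY ENTRY (`μ, ν ∈ Fin 4`; the colour factor `δ_ab` is dropped); «≤» on
absolute values. (ii) At `B = 0`, «κ_B^m» = «κ^m» by the sentence after (V.2) (translation by `λ(B̄′)·e = 0`), and `(−Δ_B^{homothetic})^{−1}`
= the flat homothetic propagator (III.3). (iii) `m = 0`: the bottom block `κ_0 = κ₀` (II.15) does not vanish at `p = 0`, where `1/p²` is
singular (the infrared end, cut off in MRS by the fixed infrared cutoff of p.328, never lifted); it is outside the ultraviolet statement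
(A.29) serves and the family is extended by `0` there — declared, exactly as file 44's `kernelFamily` for (VII.1). (iv) Fourier
convention: Mathlib's `𝓕f(z) = ∫ e^{−2πi p·z} f(p) d⁴p` (the `2π` lands in `K_q`). (v) `λ` does not occur (zero background, free
operator); `ζ` is any real (for `ζ = 0` Lean's `ζ⁻¹ = 0` gives the numerator `δ|p|² − p_μp_ν` — harmless, the statements hold). (vi) §6's translated family
is the MODEL the printed sentence describes («the zero at p = 0 of the ordinary Laplace operator p² is simply translated», «we simply
translate the cutoff without changing its shape»): the free sliced propagator and its cutoff translated by `p_B = λ(B̄′_{l,Δ})_μ·e`; the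
true constant-background operator `−Δ_B^{homothetic}` differs from it — the appendix controls it RELATIVE to the free one through the
determinant bounds (A.6) ∕ (A.27) ∕ (A.28) «up to a factor (3/23)^{12}» (p.382 – p.383 tl.7), a comparison not formalised here —
declared, not adjudicated.

**What is NOT claimed.** (A.29) for a NON-ZERO constant background (the translated slices `κ_B^m` around `p_μ = λ(B̄′)_μ·e` and the
operator `−Δ_B^{homothetic}` with `B ≠ 0` — the case the appendix is about; its zero set (A.28) is typed in file 7,
`AppendixOne.A28_eq_zero_iff`; §6 proves (A.29) only for the TRANSLATED FREE model the sentence p.383 tl.11–13 names, not for that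
operator, and the comparison between the two — the content of (A.6) ∕ (A.27) ∕ (A.28) — is not formalised); the error term `E_{l,B′}` of (V.2); Sect. V's inductive resolvent expansion; the horizontal cluster
expansion («It is this decrease which is finally used …»); anything of Bałaban's papers. MRS work at FIXED INFRARED CUTOFF: nothing
here bears on infinite volume or a mass gap.
-/

noncomputable section

open scoped ContDiff FourierTransform InnerProductSpace
open MeasureTheory

namespace Literature.MathematicalPhysics.QuantumFieldTheory.MagnenRivasseauSeneor1993

namespace HomSliceDecay

open SliceDecay (E4 E3 timeC spat emb scale scaleEquiv unitSlice)

/-! ## §1 The isotropic scaling `v ↦ a·v` and the embedding `ℝ × ℝ³ ≃ ℝ⁴` -/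

/-- The isotropic case of file 44's anisotropic scaling: `scale a a v = a • v`. [cite: MagnenRivasseauSeneor1993, App. 1 (A.29) p.383
(«with correct scaling»)] -/
theorem scale_self_eq_smul (a : ℝ) (v : E4) : scale a a v = a • v := by
  ext i
  rw [SliceDecay.scale_apply, PiLp.smul_apply, smul_eq_mul]
  refine Fin.cases ?_ (fun j => ?_) i
  · simp
  · simp

/-- Every point of `ℝ⁴` is the embedding of its (time, space) components. [cite: MagnenRivasseauSeneor1993, §VII (VII.1) p.375] -/
theorem emb_timeC_spat (w : E4) : emb (timeC w, spat w) = w := by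
  ext i
  refine Fin.cases ?_ (fun j => ?_) i
  · simp [SliceDecay.emb, SliceDecay.timeC]
  · simp [SliceDecay.emb, SliceDecay.spat]

/-! ## §2 The homothetic-gauge propagator at ZERO background, sliced: symbol and unit-scale profile -/

section Defs

variable (P : Ansatz.CutoffProfile) (η M ζ : ℝ)

/-- The polynomial numerator of the `(μ, ν)` entry of the homothetic-gauge projector: `δ_{μν}|p|² − (1 − ζ⁻¹) p_μ p_ν` (the
homothetic propagator is `δ_ab(δ_μν − (1 − ζ⁻¹)p_μp_ν/p²)/p²`, (III.3) p.348; here at zero background, colour factor `δ_ab` dropped).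
[cite: MagnenRivasseauSeneor1993, Sect. III (III.3) p.348; App. 1 (A.29) p.383] -/
def homNum (μ ν : Fin 4) (p : E4) : ℝ :=
  (if μ = ν then ‖p‖ ^ 2 else 0) - (1 - ζ⁻¹) * p μ * p ν

/-- The UNIT-SCALE profile of the `(μ, ν)` entry: `Φ_{μν}(v) = ψ(|v|) · (δ_{μν}|v|² − (1 − ζ⁻¹)v_μv_ν) / |v|⁴`, `ψ` = file 44's
`unitSlice` (the slice profile of (II.15), vanishing near `0` and beyond `3 + η⁻¹`). [cite: MagnenRivasseauSeneor1993, App. 1 (A.29)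
p.383; (II.13)–(II.15) p.331] -/
def unitHom (μ ν : Fin 4) (v : E4) : ℝ :=
  unitSlice P η M ‖v‖ * homNum ζ μ ν v * (‖v‖ ^ 4)⁻¹

/-- The `(μ, ν)` entry of the SLICED homothetic propagator at zero background, momentum space, slice `m`:
`κ^m(p) · (δ_{μν}p² − (1 − ζ⁻¹)p_μp_ν)/p⁴` with MRS's momentum slice `κ^m` of (II.15) (`Ansatz.sliceCutoff`; at zero background the
operator `−Δ_B^{homothetic}` of (V.2) is the free one and «κ_B^m» is «κ^m»). [cite: MagnenRivasseauSeneor1993, App. 1 (A.29) p.383;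
Sect. V (V.2) p.358; (II.15) p.331] -/
def homSliceMom (μ ν : Fin 4) (m : ℕ) (p : E4) : ℝ :=
  Ansatz.sliceCutoff P η M m ‖p‖ * homNum ζ μ ν p * (‖p‖ ^ 4)⁻¹

/-- … and in position space: `G^m_{μν}(z) = Re 𝓕[κ^m · hom_{μν}](z)` (Mathlib's convention `𝓕f(z) = ∫e^{−2πi p·z}f(p)d⁴p`; the
imaginary part vanishes by `p ↦ −p` symmetry and is not used). [cite: MagnenRivasseauSeneor1993, App. 1 (A.29) p.383] -/
def homSliceKernel (μ ν : Fin 4) (m : ℕ) (z : E4) : ℝ :=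
  (𝓕 (fun p : E4 => ((homSliceMom P η M ζ μ ν m p : ℝ) : ℂ)) z).re

/-- The kernel family indexed by ALL `m ∈ ℕ` as the predicate `AppendixOne.IneqA29Printed` demands: MRS's slices `m ≥ 1` (the
ultraviolet slices (II.15), `κ^m = κ_m − κ_{m−1}`), extended by `0` at `m = 0` (the bottom block `κ_0`, which does not vanish at `p = 0`,
is the infrared end handled by the fixed infrared cutoff, not by (A.29) — declared reading, as in file 44's `kernelFamily`).
[cite: MagnenRivasseauSeneor1993, App. 1 (A.29) p.383; §I p.328 tl.4–5] -/
def kernelFamily (μ ν : Fin 4) (m : ℕ) (z : E4) : ℝ :=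
  if 1 ≤ m then homSliceKernel P η M ζ μ ν m z else 0

end Defs

variable {P : Ansatz.CutoffProfile} {η M ζ : ℝ}

/-! ## §3 The unit-scale profile is smooth and compactly supported -/

/-- The numerator is a polynomial, hence smooth. [cite: MagnenRivasseauSeneor1993, Sect. III (III.3) p.348] -/
theorem contDiff_homNum (ζ : ℝ) (μ ν : Fin 4) : ContDiff ℝ ∞ (homNum ζ μ ν) := by
  unfold homNum
  have hμ : ContDiff ℝ ∞ (fun p : E4 => p μ) := contDiff_piLp_apply (𝕜 := ℝ) (p := 2) (i := μ)
  have hν : ContDiff ℝ ∞ (fun p : E4 => p ν) := contDiff_piLp_apply (𝕜 := ℝ) (p := 2) (i := ν)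
  have hsq : ContDiff ℝ ∞ (fun p : E4 => ‖p‖ ^ 2) := contDiff_norm_sq ℝ
  split_ifs
  · exact hsq.sub ((contDiff_const.mul hμ).mul hν)
  · exact contDiff_const.sub ((contDiff_const.mul hμ).mul hν)

/-- Homogeneity of degree 2 of the numerator: `homNum(a·v) = a²·homNum(v)`. [cite: MagnenRivasseauSeneor1993, App. 1 (A.29) p.383] -/
theorem homNum_smul (ζ : ℝ) (μ ν : Fin 4) (a : ℝ) (v : E4) : homNum ζ μ ν (a • v) = a ^ 2 * homNum ζ μ ν v := by
  unfold homNum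
  rw [norm_smul, Real.norm_eq_abs, mul_pow, sq_abs, PiLp.smul_apply, PiLp.smul_apply, smul_eq_mul, smul_eq_mul]
  split_ifs <;> ring

/-- **The unit-scale profile is `C^∞`** on `ℝ⁴`: smooth off `v = 0` (the inverse fourth power), identically zero near `v = 0` (the slice
profile vanishes for `|v| ≤ M⁻¹`). [cite: MagnenRivasseauSeneor1993, App. 1 (A.29) p.383 («using integration by parts on the cutoff
function»); (II.14)–(II.15) p.331] -/
theorem contDiff_unitHom (hη : 0 < η) (hM : 1 ≤ M) (ζ : ℝ) (μ ν : Fin 4) : ContDiff ℝ ∞ (unitHom P η M ζ μ ν) := by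
  have hM0 : 0 < M := by linarith
  have hψ : ContDiff ℝ ∞ (fun v : E4 => unitSlice P η M ‖v‖) := by
    have h := Ansatz.contDiff_comp_norm_mul (V := E4) (SliceDecay.contDiff_unitSlice P η M hη ⊤) (inv_pos.mpr hM0)
      (fun r hr => by rw [SliceDecay.unitSlice_eq_zero_of_le P η M hM hr.le,
        SliceDecay.unitSlice_eq_zero_of_le P η M hM (inv_pos.mpr hM0).le]) one_pos
    simpa only [one_mul] using h
  have hN : ContDiff ℝ ∞ (homNum ζ μ ν) := contDiff_homNum ζ μ ν
  have hN4 : ContDiff ℝ ∞ (fun v : E4 => ‖v‖ ^ 4) := by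
    have : (fun v : E4 => ‖v‖ ^ 4) = fun v => (‖v‖ ^ 2) ^ 2 := by funext v; ring
    rw [this]; exact (contDiff_norm_sq ℝ).pow 2
  rw [contDiff_iff_contDiffAt]
  intro v
  by_cases hv : v = 0
  · subst hv
    have hopen : IsOpen {w : E4 | ‖w‖ < M⁻¹} := isOpen_lt continuous_norm continuous_const
    have hmem : (0 : E4) ∈ {w : E4 | ‖w‖ < M⁻¹} := by
      show ‖(0 : E4)‖ < M⁻¹; rw [norm_zero]; exact inv_pos.mpr hM0
    have hev : ∀ᶠ w in nhds (0 : E4), unitHom P η M ζ μ ν w = 0 := by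
      filter_upwards [hopen.mem_nhds hmem] with w hw
      have h0 : unitSlice P η M ‖w‖ = 0 := SliceDecay.unitSlice_eq_zero_of_le P η M hM (le_of_lt hw)
      simp only [unitHom, h0, zero_mul]
    exact (contDiffAt_const (c := (0 : ℝ))).congr_of_eventuallyEq hev
  · have hne : ‖v‖ ^ 4 ≠ 0 := pow_ne_zero 4 (norm_ne_zero_iff.mpr hv)
    exact (hψ.contDiffAt.mul hN.contDiffAt).mul (hN4.contDiffAt.inv hne)

/-- **Compact support**: `Φ_{μν}` vanishes for `|v| ≥ 3 + η⁻¹` (the slice profile does), so its support lies in that closed ball.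
[cite: MagnenRivasseauSeneor1993, (II.14)–(II.15) p.331; App. 1 (A.29) p.383] -/
theorem support_unitHom_subset (hη : 0 < η) (hM : 1 ≤ M) (ζ : ℝ) (μ ν : Fin 4) :
    Function.support (unitHom P η M ζ μ ν) ⊆ Metric.closedBall (0 : E4) (3 + η⁻¹) := by
  intro v hv
  rw [Function.mem_support, unitHom] at hv
  rw [Metric.mem_closedBall, dist_zero_right]
  by_contra h
  rw [not_le] at h
  exact hv (by rw [SliceDecay.unitSlice_eq_zero_of_ge P η M hη hM h.le, zero_mul, zero_mul])

/-- **Uniform Fourier decay of the sixteen unit-scale profiles**: for every `n` ONE constant `K ≥ 0` with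
`|𝓕[Φ_{μν}](w)| ≤ K(1 + |w|)^{−n}` for all `μ, ν, w` (file 44's integration-by-parts lemma `SliceDecay.exists_fourier_family_le`).
[cite: MagnenRivasseauSeneor1993, App. 1 (A.29) p.383 («using integration by parts on the cutoff function»)] -/
theorem exists_fourier_unitHom_le (hη : 0 < η) (hM : 1 ≤ M) (ζ : ℝ) (n : ℕ) :
    ∃ K : ℝ, 0 ≤ K ∧ ∀ (μ ν : Fin 4) (w : E4), ‖𝓕 (fun v => ((unitHom P η M ζ μ ν v : ℝ) : ℂ)) w‖ ≤ K * ((1 + ‖w‖) ^ n)⁻¹ := by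
  -- one constant per pair (μ, ν), through the generic lemma with a dummy parameter
  have hpair : ∀ μ ν : Fin 4, ∃ K : ℝ, 0 ≤ K ∧ ∀ w : E4,
      ‖𝓕 (fun v => ((unitHom P η M ζ μ ν v : ℝ) : ℂ)) w‖ ≤ K * ((1 + ‖w‖) ^ n)⁻¹ := by
    intro μ ν
    have hΦ : ContDiff ℝ ∞ (fun q : ℝ × E4 => unitHom P η M ζ μ ν q.2) :=
      (contDiff_unitHom hη hM ζ μ ν).comp contDiff_snd
    obtain ⟨K, hK0, hK⟩ := SliceDecay.exists_fourier_family_le (Pm := ℝ) hΦ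
      (fun _ => support_unitHom_subset hη hM ζ μ ν) (isCompact_singleton (x := (0 : ℝ))) n
    exact ⟨K, hK0, fun w => hK 0 (Set.mem_singleton 0) w⟩
  choose K hK0 hK using hpair
  refine ⟨∑ μ, ∑ ν, K μ ν, Finset.sum_nonneg fun μ _ => Finset.sum_nonneg fun ν _ => hK0 μ ν, fun μ ν w => ?_⟩
  have hle : K μ ν ≤ ∑ μ', ∑ ν', K μ' ν' := by
    calc K μ ν ≤ ∑ ν', K μ ν' := Finset.single_le_sum (f := fun ν' => K μ ν') (fun ν' _ => hK0 μ ν') (Finset.mem_univ ν)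
      _ ≤ ∑ μ', ∑ ν', K μ' ν' :=
        Finset.single_le_sum (f := fun μ' => ∑ ν', K μ' ν') (fun μ' _ => Finset.sum_nonneg fun ν' _ => hK0 μ' ν')
          (Finset.mem_univ μ)
  exact (hK μ ν w).trans (mul_le_mul_of_nonneg_right hle (by positivity))

/-! ## §4 Exact scaling: slice `m ≥ 1` is a dilate of the unit-scale profile -/

/-- `|a·v| = a|v|` for `a ≥ 0`. [folklore] -/
private theorem norm_smul_of_nonneg {a : ℝ} (ha : 0 ≤ a) (v : E4) : ‖a • v‖ = a * ‖v‖ := by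
  rw [norm_smul, Real.norm_eq_abs, abs_of_nonneg ha]

/-- **Exact scaling** («κ_B^m … with correct scaling»): for `a = M^{k+1}`, `C^{k+1}_{μν}(a·v) = a^{−2}·Φ_{μν}(v)` — the slice
cutoff is `κ^{k+1}(r) = ψ(r/M^{k+1})` and the rational factor is homogeneous of degree `−2`.
[cite: MagnenRivasseauSeneor1993, App. 1 (A.29) p.383; (II.13)–(II.15) p.331] -/
theorem homSliceMom_scale (hM : 0 < M) (ζ : ℝ) (μ ν : Fin 4) (k : ℕ) (v : E4) :
    homSliceMom P η M ζ μ ν (k + 1) (scale (M ^ (k + 1)) (M ^ (k + 1)) v) =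
      ((M ^ (k + 1)) ^ 2)⁻¹ * unitHom P η M ζ μ ν v := by
  set a : ℝ := M ^ (k + 1) with ha
  have ha0 : 0 < a := pow_pos hM _
  rw [scale_self_eq_smul, homSliceMom, unitHom, norm_smul_of_nonneg ha0.le, homNum_smul,
    SliceDecay.sliceCutoff_succ_eq_unitSlice P η M hM k]
  by_cases hv : v = 0
  · subst hv; simp
  · have hv' : ‖v‖ ≠ 0 := norm_ne_zero_iff.mpr hv
    rw [← ha]
    field_simp

/-! ## §5 (A.29) PROVED at zero background -/

/-- **The decay bound, explicit structure**: for `η > 0`, `M > 1`, any `ζ` and every `q` there is `K_q ≥ 0` (depending on `q`, `M`,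
`η`, `ζ`, the profile — not on `m`, `μ`, `ν`) with `|G^{m}_{μν}(z)| ≤ K_q M^{2m} (1 + M^m|z|)^{−q}` for all slices `m ≥ 1`, all entries
and all `z ∈ ℝ⁴`. [cite: MagnenRivasseauSeneor1993, App. 1 (A.29) p.383 tl.13–18] -/
theorem exists_homSliceKernel_bound (hη : 0 < η) (hM : 1 < M) (ζ : ℝ) (q : ℕ) :
    ∃ Kq : ℝ, 0 ≤ Kq ∧ ∀ (μ ν : Fin 4) (k : ℕ) (z : E4),
      |homSliceKernel P η M ζ μ ν (k + 1) z| ≤ Kq * M ^ (2 * (k + 1)) * ((1 + M ^ (k + 1) * ‖z‖) ^ q)⁻¹ := by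
  have hM0 : 0 < M := by linarith
  obtain ⟨K, hK0, hK⟩ := exists_fourier_unitHom_le (P := P) hη hM.le ζ q
  refine ⟨K, hK0, fun μ ν k z => ?_⟩
  set a : ℝ := M ^ (k + 1) with ha
  have ha0 : 0 < a := pow_pos hM0 _
  have hscale := fun v => homSliceMom_scale (P := P) (η := η) hM0 ζ μ ν k v
  have h := SliceDecay.abs_re_fourier_le_of_scale (h := homSliceMom P η M ζ μ ν (k + 1)) (F := unitHom P η M ζ μ ν)
    (a := a) (b := a) (c := (a ^ 2)⁻¹) (K := K) (n := q) ha0 ha0 hscale (hK μ ν) (timeC z, spat z)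
  rw [emb_timeC_spat] at h
  have hnorm : ‖scale a a z‖ = a * ‖z‖ := by rw [scale_self_eq_smul, norm_smul_of_nonneg ha0.le]
  rw [hnorm, abs_of_pos (by positivity : (0 : ℝ) < (a ^ 2)⁻¹)] at h
  have hcoef : (a ^ 2)⁻¹ * (a * a ^ 3) * K = K * M ^ (2 * (k + 1)) := by
    rw [ha]; field_simp; ring
  rw [homSliceKernel]
  calc |(𝓕 (fun p : E4 => ((homSliceMom P η M ζ μ ν (k + 1) p : ℝ) : ℂ)) z).re|
      ≤ (a ^ 2)⁻¹ * (a * a ^ 3) * K * ((1 + a * ‖z‖) ^ q)⁻¹ := h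
    _ = K * M ^ (2 * (k + 1)) * ((1 + M ^ (k + 1) * ‖z‖) ^ q)⁻¹ := by rw [hcoef]

/-- **(A.29) PROVED at zero background** in the printed quantifier shape `∀ q, ∃ K_q, ∀ m, ∀ (x − y)` of the tree's AS-PRINTED predicate
`AppendixOne.IneqA29Printed` (file `MRS93AppendixFeynmanGauge`, where it was typed and left unproved): *«κ_B^m ∗ (−Δ_B^{homothetic})^{−1}
(x, y) ≤ K_q M^{2m}(1/(1 + M^m|x − y|))^q (A.29)»* — for every entry `(μ, ν)` of the sliced homothetic-gauge propagator at the constant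
background `B = 0` (where `−Δ_B^{homothetic}` is the free operator with symbol `p²(δ_μν − (1 − ζ⁻¹)p_μp_ν/p²)⁻¹`), built from MRS's own
cutoff (II.14) and slices (II.15), every gauge parameter `ζ`, every `η > 0`, `M > 1`. [cite: MagnenRivasseauSeneor1993, App. 1
(A.29) p.383 tl.13–18] -/
theorem ineqA29Printed_kernelFamily (hη : 0 < η) (hM : 1 < M) (ζ : ℝ) (μ ν : Fin 4) :
    AppendixOne.IneqA29Printed (kernelFamily P η M ζ μ ν) M := by
  intro q
  obtain ⟨Kq, hKq0, hKq⟩ := exists_homSliceKernel_bound (P := P) hη hM ζ q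
  refine ⟨Kq, fun m z => ?_⟩
  unfold kernelFamily
  split_ifs with hm
  · obtain ⟨k, rfl⟩ : ∃ k, m = k + 1 := ⟨m - 1, by omega⟩
    have h := hKq μ ν k z
    rw [one_div, inv_pow]
    exact h
  · rw [abs_zero]
    have hM0 : 0 < M := by linarith
    positivity

/-! ## §6 «the zero at p = 0 of the ordinary Laplace operator p² is simply translated» (p.383 tl.11–13) ∕ (V.2) «we simply translate the
cutoff without changing its shape»: the TRANSLATED MODEL family — (A.29) with one `K_q` for EVERY translation `p_B` -/

section Translated

variable (P : Ansatz.CutoffProfile) (η M ζ : ℝ) (pB : E4)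

/-- The printed heuristic typed as a MODEL (reading (vi)): the sliced propagator with its zero AND its slice cutoff translated to the
momentum `p_B` («κ^m_{B′} restricts |p_μ − λ(B̄′_{l,Δ})_μ.e| to be of order M^m, i.e. we simply translate the cutoff without changing its
shape»; «for a fixed B … the zero at p = 0 of the ordinary Laplace operator p² is simply translated»):
`C^m_{p_B,μν}(p) = κ^m(|p − p_B|)·hom_{μν}(p − p_B)/|p − p_B|⁴`. This is NOT MRS's operator `(−Δ_B^{homothetic})^{−1}` for `B ≠ 0`
(whose symbol is the matrix studied in (A.6) ∕ (A.27) ∕ (A.28)); it is the translated free one the sentence names.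
[cite: MagnenRivasseauSeneor1993, App. 1 (A.29) p.383 tl.11–13; Sect. V (V.2) p.358 tl.41–42] -/
def homSliceMomTr (μ ν : Fin 4) (m : ℕ) (p : E4) : ℝ :=
  homSliceMom P η M ζ μ ν m (p - pB)

/-- … in position space: `G^m_{p_B,μν}(z) = Re 𝓕[C^m_{p_B,μν}](z)`, kernel of `z = x − y`. [cite: MagnenRivasseauSeneor1993, App. 1
(A.29) p.383] -/
def homSliceKernelTr (μ ν : Fin 4) (m : ℕ) (z : E4) : ℝ :=
  (𝓕 (fun p : E4 => ((homSliceMomTr P η M ζ pB μ ν m p : ℝ) : ℂ)) z).re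

/-- The translated family over all `m ∈ ℕ` (`m ≥ 1` the slices, `m = 0 ↦ 0` as in `kernelFamily`, reading (iii)).
[cite: MagnenRivasseauSeneor1993, App. 1 (A.29) p.383; Sect. V (V.2) p.358] -/
def kernelFamilyTr (μ ν : Fin 4) (m : ℕ) (z : E4) : ℝ :=
  if 1 ≤ m then homSliceKernelTr P η M ζ pB μ ν m z else 0

variable {P η M ζ pB}

/-- At `p_B = 0` the translated model is the zero-background family of §2. [cite: MagnenRivasseauSeneor1993, Sect. V (V.2) p.358
tl.41–42 (translation by `λ(B̄′)·e = 0` at `B̄′ = 0`)] -/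
theorem kernelFamilyTr_zero (μ ν : Fin 4) : kernelFamilyTr P η M ζ 0 μ ν = kernelFamily P η M ζ μ ν := by
  funext m z
  simp only [kernelFamilyTr, kernelFamily, homSliceKernelTr, homSliceKernel, homSliceMomTr, sub_zero]

/-- `𝓕` is linear over real constants (file 44's private helper, restated). [folklore] -/
private theorem fourier_const_mul' (c : ℝ) (f : E4 → ℂ) (x : E4) :
    𝓕 (fun p => (c : ℂ) * f p) x = (c : ℂ) * 𝓕 f x := by
  rw [Real.fourier_eq, Real.fourier_eq, ← integral_const_mul]
  congr 1; funext v
  simp only [Circle.smul_def]; ring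

/-- Translation in momentum space is a phase in position space: `|𝓕[f(· − p_B)](z)| = |𝓕f(z)|` (Mathlib's
`VectorFourier.fourierIntegral_comp_add_right`). [folklore] -/
private theorem norm_fourier_translate (f : E4 → ℂ) (pB z : E4) :
    ‖𝓕 (fun p : E4 => f (p - pB)) z‖ = ‖𝓕 f z‖ := by
  have hcomp : (fun p : E4 => f (p - pB)) = f ∘ fun v => v + -pB := by
    funext p; simp [sub_eq_add_neg]
  rw [hcomp]
  have h := congrFun (VectorFourier.fourierIntegral_comp_add_right 𝐞 volume (innerₗ E4) f (-pB)) z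
  show ‖VectorFourier.fourierIntegral 𝐞 volume (innerₗ E4) (f ∘ fun v => v + -pB) z‖ =
    ‖VectorFourier.fourierIntegral 𝐞 volume (innerₗ E4) f z‖
  rw [h, Circle.norm_smul]

/-- NORM form of file 44's assembly `SliceDecay.abs_re_fourier_le_of_scale`: an exact anisotropic dilate `h(a v₀, b v⃗) = c·F(v)` of a
profile with `|𝓕F(w)| ≤ K(1 + |w|)^{−n}` has `|𝓕h(z)| ≤ |c|·ab³·K·(1 + |(a z₀, b z⃗)|)^{−n}` (complex modulus, not only the real part —
needed once a translation phase multiplies the transform). [cite: MagnenRivasseauSeneor1993, App. 1 (A.29) p.383 («with correct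
scaling»); §VII (VII.1) p.375] -/
theorem norm_fourier_le_of_scale {h F : E4 → ℝ} {a b c K : ℝ} (ha : 0 < a) (hb : 0 < b) {n : ℕ}
    (hscale : ∀ v, h (scale a b v) = c * F v)
    (hF : ∀ w, ‖𝓕 (fun v => ((F v : ℝ) : ℂ)) w‖ ≤ K * ((1 + ‖w‖) ^ n)⁻¹) (z : E4) :
    ‖𝓕 (fun p => ((h p : ℝ) : ℂ)) z‖ ≤ |c| * (a * b ^ 3) * K * ((1 + ‖scale a b z‖) ^ n)⁻¹ := by
  set A := scaleEquiv a b ha.ne' hb.ne' with hA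
  have hmom : (fun p : E4 => ((h p : ℝ) : ℂ)) = fun p => ((c : ℝ) : ℂ) * ((F (A.symm p) : ℝ) : ℂ) := by
    funext p
    have hp : scale a b (A.symm p) = p := by
      rw [hA]; exact (scaleEquiv a b ha.ne' hb.ne').apply_symm_apply p
    rw [← Complex.ofReal_mul, ← hscale, hp]
  have hAsym : ∀ u v : E4, ⟪A u, v⟫_ℝ = ⟪u, A v⟫_ℝ := fun u v => by
    rw [hA, SliceDecay.scaleEquiv_apply, SliceDecay.scaleEquiv_apply, SliceDecay.inner_scale_comm]
  have hdet : LinearMap.det (A.toLinearEquiv : E4 →ₗ[ℝ] E4) = a * b ^ 3 := by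
    rw [show (A.toLinearEquiv : E4 →ₗ[ℝ] E4) = (scale a b : E4 →ₗ[ℝ] E4) from rfl, SliceDecay.det_scale]
  have h1 : 𝓕 (fun p : E4 => ((c : ℝ) : ℂ) * ((F (A.symm p) : ℝ) : ℂ)) z =
      ((c : ℝ) : ℂ) * 𝓕 (fun p => ((F (A.symm p) : ℝ) : ℂ)) z :=
    fourier_const_mul' _ (fun p => ((F (A.symm p) : ℝ) : ℂ)) _
  have h2 : 𝓕 (fun p => ((F (A.symm p) : ℝ) : ℂ)) z =
      (((|LinearMap.det (A.toLinearEquiv : E4 →ₗ[ℝ] E4)| : ℝ)) : ℂ) * 𝓕 (fun v => ((F v : ℝ) : ℂ)) (A z) :=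
    SliceDecay.fourier_comp_symm A hAsym (fun v => ((F v : ℝ) : ℂ)) z
  have hAz : A z = scale a b z := rfl
  rw [hmom, h1, h2, hdet, hAz, ← mul_assoc, ← Complex.ofReal_mul]
  calc ‖(((c * |a * b ^ 3| : ℝ)) : ℂ) * 𝓕 (fun v => ((F v : ℝ) : ℂ)) (scale a b z)‖
      = |c| * (a * b ^ 3) * ‖𝓕 (fun v => ((F v : ℝ) : ℂ)) (scale a b z)‖ := by
        rw [norm_mul, Complex.norm_real, Real.norm_eq_abs, abs_mul, abs_abs,
          abs_of_pos (show 0 < a * b ^ 3 by positivity)]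
    _ ≤ |c| * (a * b ^ 3) * (K * ((1 + ‖scale a b z‖) ^ n)⁻¹) := by
        refine mul_le_mul_of_nonneg_left (hF _) ?_
        exact mul_nonneg (abs_nonneg _) (by positivity)
    _ = |c| * (a * b ^ 3) * K * ((1 + ‖scale a b z‖) ^ n)⁻¹ := by ring

/-- The zero-background slices in COMPLEX MODULUS: `∀ q ∃ K_q ≥ 0 ∀ μ ν ∀ m ≥ 1 ∀ z`, `|𝓕[C^m_{μν}](z)| ≤ K_q M^{2m}(1 + M^m|z|)^{−q}`
(the bound of §5 before taking real parts). [cite: MagnenRivasseauSeneor1993, App. 1 (A.29) p.383 tl.13–18] -/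
theorem exists_norm_fourier_homSliceMom_le (hη : 0 < η) (hM : 1 < M) (ζ : ℝ) (q : ℕ) :
    ∃ Kq : ℝ, 0 ≤ Kq ∧ ∀ (μ ν : Fin 4) (k : ℕ) (z : E4),
      ‖𝓕 (fun p : E4 => ((homSliceMom P η M ζ μ ν (k + 1) p : ℝ) : ℂ)) z‖ ≤
        Kq * M ^ (2 * (k + 1)) * ((1 + M ^ (k + 1) * ‖z‖) ^ q)⁻¹ := by
  have hM0 : 0 < M := by linarith
  obtain ⟨K, hK0, hK⟩ := exists_fourier_unitHom_le (P := P) hη hM.le ζ q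
  refine ⟨K, hK0, fun μ ν k z => ?_⟩
  set a : ℝ := M ^ (k + 1) with ha
  have ha0 : 0 < a := pow_pos hM0 _
  have hscale := fun v => homSliceMom_scale (P := P) (η := η) hM0 ζ μ ν k v
  have h := norm_fourier_le_of_scale (h := homSliceMom P η M ζ μ ν (k + 1)) (F := unitHom P η M ζ μ ν)
    (a := a) (b := a) (c := (a ^ 2)⁻¹) (K := K) (n := q) ha0 ha0 hscale (hK μ ν) z
  have hnorm : ‖scale a a z‖ = a * ‖z‖ := by rw [scale_self_eq_smul, norm_smul_of_nonneg ha0.le]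
  rw [hnorm, abs_of_pos (by positivity : (0 : ℝ) < (a ^ 2)⁻¹)] at h
  have hcoef : (a ^ 2)⁻¹ * (a * a ^ 3) * K = K * M ^ (2 * (k + 1)) := by
    rw [ha]; field_simp; ring
  calc ‖𝓕 (fun p : E4 => ((homSliceMom P η M ζ μ ν (k + 1) p : ℝ) : ℂ)) z‖
      ≤ (a ^ 2)⁻¹ * (a * a ^ 3) * K * ((1 + a * ‖z‖) ^ q)⁻¹ := h
    _ = K * M ^ (2 * (k + 1)) * ((1 + M ^ (k + 1) * ‖z‖) ^ q)⁻¹ := by rw [hcoef]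

/-- **(A.29) for the translated model, UNIFORMLY in the translation**: for `η > 0`, `M > 1`, any `ζ` and every `q` there is ONE
`K_q ≥ 0` with `|G^m_{p_B,μν}(z)| ≤ K_q M^{2m}(1 + M^m|z|)^{−q}` for ALL `p_B ∈ ℝ⁴`, all `m ≥ 1`, all entries, all `z` — the
translation is a phase `e^{−2πi p_B·z}` in position space and does not touch the modulus («we simply translate the cutoff without
changing its shape»; p.359 «we have now for each slice of the propagator in the background field the same scaling and, using
integration by parts, the same spatial decrease as for the ordinary slices with the ordinary propagator»).
[cite: MagnenRivasseauSeneor1993, App. 1 (A.29) p.383 tl.11–18; Sect. V (V.2) p.358 tl.41–42, p.359 lines 1–5] -/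
theorem exists_homSliceKernelTr_bound (hη : 0 < η) (hM : 1 < M) (ζ : ℝ) (q : ℕ) :
    ∃ Kq : ℝ, 0 ≤ Kq ∧ ∀ (pB : E4) (μ ν : Fin 4) (k : ℕ) (z : E4),
      |homSliceKernelTr P η M ζ pB μ ν (k + 1) z| ≤ Kq * M ^ (2 * (k + 1)) * ((1 + M ^ (k + 1) * ‖z‖) ^ q)⁻¹ := by
  obtain ⟨Kq, hKq0, hKq⟩ := exists_norm_fourier_homSliceMom_le (P := P) hη hM ζ q
  refine ⟨Kq, hKq0, fun pB μ ν k z => ?_⟩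
  rw [homSliceKernelTr]
  have htr := norm_fourier_translate (fun p : E4 => ((homSliceMom P η M ζ μ ν (k + 1) p : ℝ) : ℂ)) pB z
  calc |(𝓕 (fun p : E4 => ((homSliceMomTr P η M ζ pB μ ν (k + 1) p : ℝ) : ℂ)) z).re|
      ≤ ‖𝓕 (fun p : E4 => ((homSliceMomTr P η M ζ pB μ ν (k + 1) p : ℝ) : ℂ)) z‖ := Complex.abs_re_le_norm _
    _ = ‖𝓕 (fun p : E4 => ((homSliceMom P η M ζ μ ν (k + 1) p : ℝ) : ℂ)) z‖ := by
        simpa only [homSliceMomTr] using htr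
    _ ≤ Kq * M ^ (2 * (k + 1)) * ((1 + M ^ (k + 1) * ‖z‖) ^ q)⁻¹ := hKq μ ν k z

/-- **(A.29) AS PRINTED for the translated model**: `AppendixOne.IneqA29Printed (kernelFamilyTr P η M ζ p_B μ ν) M` for every
translation `p_B` and every entry — with the SAME `K_q` as at `p_B = 0` (the constant of `exists_homSliceKernelTr_bound` does not
depend on `p_B`). [cite: MagnenRivasseauSeneor1993, App. 1 (A.29) p.383 tl.11–18; Sect. V (V.2) p.358] -/
theorem ineqA29Printed_kernelFamilyTr (hη : 0 < η) (hM : 1 < M) (ζ : ℝ) (pB : E4) (μ ν : Fin 4) :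
    AppendixOne.IneqA29Printed (kernelFamilyTr P η M ζ pB μ ν) M := by
  intro q
  obtain ⟨Kq, hKq0, hKq⟩ := exists_homSliceKernelTr_bound (P := P) hη hM ζ q
  refine ⟨Kq, fun m z => ?_⟩
  unfold kernelFamilyTr
  split_ifs with hm
  · obtain ⟨k, rfl⟩ : ∃ k, m = k + 1 := ⟨m - 1, by omega⟩
    have h := hKq pB μ ν k z
    rw [one_div, inv_pow]
    exact h
  · rw [abs_zero]
    have hM0 : 0 < M := by linarith
    positivity

end Translated

/-! ## §7 The same bounds in the phase convention `∫ e^{ip·(x−y)} (…) d⁴p` of [R] (III.3.3) (as file 44 §8 for (VII.1)) -/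

section PhysConvention

variable (P : Ansatz.CutoffProfile) (η M ζ : ℝ) (pB : E4)

/-- The translated kernel in the convention `G(x − y) = ∫ e^{ip·(x−y)} C(p) d⁴p` (no `2π` in the phase; [R] (III.3.3)):
`= Re (𝓕 C)(−(x−y)/2π)` in Mathlib's convention. [cite: MagnenRivasseauSeneor1993, App. 1 (A.29) p.383; Rivasseau1991, §III.3
(III.3.3) p.212] -/
def homSliceKernelTrPhys (μ ν : Fin 4) (m : ℕ) (z : E4) : ℝ :=
  homSliceKernelTr P η M ζ pB μ ν m ((-(2 * Real.pi)⁻¹) • z)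

/-- the family over all `m` in the `e^{ip·(x−y)}` convention (`m = 0 ↦ 0`). [cite: MagnenRivasseauSeneor1993, App. 1 (A.29) p.383] -/
def kernelFamilyTrPhys (μ ν : Fin 4) (m : ℕ) (z : E4) : ℝ :=
  if 1 ≤ m then homSliceKernelTrPhys P η M ζ pB μ ν m z else 0

variable {P η M ζ pB}

/-- `1/(1 + t/c) ≤ c/(1 + t)` for `t ≥ 0`, `c ≥ 1` (the change of phase convention costs `(2π)` per decay power). [folklore] -/
private theorem decay_rescale' {t c : ℝ} (ht : 0 ≤ t) (hc : 1 ≤ c) : 1 / (1 + t * c⁻¹) ≤ c * (1 / (1 + t)) := by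
  have hc0 : 0 < c := by linarith
  have h1 : c * (1 / (1 + t)) = c / (1 + t) := by ring
  rw [h1, div_le_div_iff₀ (by positivity) (by positivity), one_mul]
  have : c * (1 + t * c⁻¹) = c + t := by field_simp
  nlinarith [this]

/-- **(A.29) in the phase convention `e^{ip·(x−y)}`**, for the translated model (hence, at `p_B = 0`, for the zero-background family):
the same statement with `K_q` replaced by `(2π)^q K_q`. [cite: MagnenRivasseauSeneor1993, App. 1 (A.29) p.383 tl.11–18; Rivasseau1991,
§III.3 (III.3.3) p.212] -/
theorem ineqA29Printed_kernelFamilyTrPhys (hη : 0 < η) (hM : 1 < M) (ζ : ℝ) (pB : E4) (μ ν : Fin 4) :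
    AppendixOne.IneqA29Printed (kernelFamilyTrPhys P η M ζ pB μ ν) M := by
  intro q
  obtain ⟨Kq, hKq0, hKq⟩ := exists_homSliceKernelTr_bound (P := P) hη hM ζ q
  have hM0 : 0 < M := by linarith
  have h2π : 1 ≤ 2 * Real.pi := by linarith [Real.pi_gt_three]
  refine ⟨(2 * Real.pi) ^ q * Kq, fun m z => ?_⟩
  unfold kernelFamilyTrPhys
  split_ifs with hm
  · obtain ⟨k, rfl⟩ : ∃ k, m = k + 1 := ⟨m - 1, by omega⟩
    rw [homSliceKernelTrPhys]
    have h := hKq pB μ ν k ((-(2 * Real.pi)⁻¹) • z)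
    refine h.trans ?_
    have e1 : ‖(-(2 * Real.pi)⁻¹) • z‖ = ‖z‖ * (2 * Real.pi)⁻¹ := by
      rw [norm_smul, Real.norm_eq_abs, abs_neg, abs_inv, abs_of_pos (by positivity), mul_comm]
    rw [e1]
    have ha : ((1 + M ^ (k + 1) * (‖z‖ * (2 * Real.pi)⁻¹)) ^ q)⁻¹ ≤ (2 * Real.pi) ^ q * (1 / (1 + M ^ (k + 1) * ‖z‖)) ^ q := by
      have hresc := decay_rescale' (t := M ^ (k + 1) * ‖z‖) (c := 2 * Real.pi) (by positivity) h2π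
      have hpow := pow_le_pow_left₀ (by positivity) hresc q
      rw [mul_pow] at hpow
      have hrew : ((1 + M ^ (k + 1) * (‖z‖ * (2 * Real.pi)⁻¹)) ^ q)⁻¹ =
          (1 / (1 + M ^ (k + 1) * ‖z‖ * (2 * Real.pi)⁻¹)) ^ q := by
        rw [one_div, inv_pow, mul_assoc]
      rw [hrew]; exact hpow
    calc Kq * M ^ (2 * (k + 1)) * ((1 + M ^ (k + 1) * (‖z‖ * (2 * Real.pi)⁻¹)) ^ q)⁻¹
        ≤ Kq * M ^ (2 * (k + 1)) * ((2 * Real.pi) ^ q * (1 / (1 + M ^ (k + 1) * ‖z‖)) ^ q) :=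
          mul_le_mul_of_nonneg_left ha (by positivity)
      _ = (2 * Real.pi) ^ q * Kq * M ^ (2 * (k + 1)) * (1 / (1 + M ^ (k + 1) * ‖z‖)) ^ q := by ring
  · rw [abs_zero]
    positivity

/-- At `p_B = 0`: (A.29) in the `e^{ip·(x−y)}` convention for the zero-background family of §2 read in that convention.
[cite: MagnenRivasseauSeneor1993, App. 1 (A.29) p.383 tl.11–18; Rivasseau1991, §III.3 (III.3.3) p.212] -/
theorem ineqA29Printed_kernelFamilyPhys_zero (hη : 0 < η) (hM : 1 < M) (ζ : ℝ) (μ ν : Fin 4) :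
    AppendixOne.IneqA29Printed (kernelFamilyTrPhys P η M ζ 0 μ ν) M :=
  ineqA29Printed_kernelFamilyTrPhys hη hM ζ 0 μ ν

end PhysConvention

end HomSliceDecay

end Literature.MathematicalPhysics.QuantumFieldTheory.MagnenRivasseauSeneor1993
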